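import Summits.CriticalPhenomena.PercolationContinuityZ3.Theorems.PercNearOneGluingNoHeavyLowerTailWeakestPortPeeling
import HarnessLib

/-!
# `NoHeavyLowerTail` (stmt-CriticalPhenomena-4575) — weakest-port peeling: the free ANCHOR step

Support file (lemma factory `prim-lf-3` gen 6, seat g7; `--supports stmt-CriticalPhenomena-4575`).  No definitions, no named
facts, no sorries.  Companion of `…WeakestPortPeeling.lean` (`WeakestPort.weakestPort_peel`).  Memo: prim-lf-3/LF3-Q9LP.md §9.

* `WeakestPort.anchor_peel` — for a one-layer observer `o` and ANY vertex `a ≠ o`: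
  `(1 − w(o,a))·T_a(w minus s(o,a)) ≤ T_a(w)`, `T_a(u) := μ_u(o ↔ b) − μ_u(a ↔ b, o ↔ A)`.
  (When `a` is a port, deleting its pair is free up to the factor `1 − w(o,a)`; when it is not, `w(o,a) = 0` and nothing happens.)
  Together with `weakestPort_peel` (peel the port weakest off `o`) this yields the anchor-first / weakest-first decision-list lower
  bound `T_a(O) ≥ DL′(a)` of the memo, which certifies Kozma–Nitzan's Question 9 at depth two (hp-1's (★)) in every random
  instance tested (memo §9) — a proved bound, not a complete certificate (two adversarial exceptions recorded there).
-/

namespace Summit.CriticalPhenomena.PercolationContinuityZ3.Theorems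

open MeasureTheory Set ProbabilityTheory
open Literature.Probability.LatticeModels
open Literature.Probability.Percolation

noncomputable section
open Classical

namespace WeakestPort

variable {n : ℕ}

/-- **Anchor-first peeling (the free step).**  If the anchor `a` is itself a port of the one-layer observer `o`, deleting the pair
`s(o,a)` costs only the factor `1 − w(o,a)`: `(1 − w(o,a))·T_a(w minus s(o,a)) ≤ T_a(w)`, because on the patterns attaching `a` the
functional's integrand is nonnegative (`a ↔ b` forces `o ↔ b`).  With `weakestPort_peel` this gives the anchor-first, weakest-first
decision list of the memo (§9). [cite: KozmaNitzan2024, inequality (2) (p. 3), Question 9 (p. 36)] -/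
theorem anchor_peel (w : Sym2 (Fin n) → unitInterval) (A : Finset (Fin n)) (o b a : Fin n) (hao : a ≠ o) :
    (1 - (w s(o, a) : ℝ)) *
        ((prodBernoulli (fun f => if f = s(o, a) then 0 else w f)).real (openConn o b) -
          (prodBernoulli (fun f => if f = s(o, a) then 0 else w f)).real (openConn a b ∩ ⋃ x ∈ A, openConn o x)) ≤
      (prodBernoulli w).real (openConn o b) - (prodBernoulli w).real (openConn a b ∩ ⋃ x ∈ A, openConn o x) := by
  classical
  set e : Sym2 (Fin n) := s(o, a) with he
  set wm : Sym2 (Fin n) → unitInterval := fun f => if f = e then 0 else w f with hwm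
  set wp : Sym2 (Fin n) → unitInterval := fun f => if f = e then 1 else w f with hwp
  set U : Set (BondConfig (Fin n)) := ⋃ x ∈ A, openConn o x with hU
  have s1 := real_split_pair w e (openConn o b)
  have s2 := real_split_pair w e (openConn a b ∩ U)
  -- under `wp` (pair glued), `{a ↔ b, o ↔ A} ⊆ {o ↔ b}` up to the push-forward
  have hpush : ∀ X : Set (BondConfig (Fin n)), (prodBernoulli wp).real X =
      (prodBernoulli w).real {ω | ((ω ∪ {e} : Set (Sym2 (Fin n))) : BondConfig (Fin n)) ∈ X} := by
    intro X
    exact glueSet_pushforward w wp {e} (fun f hf => by rw [mem_singleton_iff.1 hf]; simp [hwp])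
      (fun f hf => by
        have hf' : f ≠ e := fun h => hf (h ▸ mem_singleton _)
        simp [hwp, hf']) X
  have hle : (prodBernoulli wp).real (openConn a b ∩ U) ≤ (prodBernoulli wp).real (openConn o b) := by
    rw [hpush, hpush]
    refine measureReal_mono ?_ (measure_ne_top _ _)
    rintro ω ⟨hab, -⟩
    have hab' : (openGraph ((ω ∪ {e} : Set (Sym2 (Fin n))) : BondConfig (Fin n))).Reachable a b := hab
    have hoa : (openGraph ((ω ∪ {e} : Set (Sym2 (Fin n))) : BondConfig (Fin n))).Reachable o a :=
      ((openGraph_adj _ o a).2 ⟨Or.inr (mem_singleton _), hao.symm⟩).reachable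
    exact hoa.trans hab'
  have hp0 : 0 ≤ (w e : ℝ) := (w e).2.1
  rw [s1, s2]
  nlinarith [mul_le_mul_of_nonneg_left hle hp0]

end WeakestPort

end

end Summit.CriticalPhenomena.PercolationContinuityZ3.Theorems
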